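import Mathlib
import Literature.MathematicalPhysics.QuantumFieldTheory.Balaban1983to89.B5QGQInverseL2Zd

/-!
# [B5] (1.104)–(1.107) pp.34–35 — the projection `P = I − G'Q'*(Q'G'Q'*)⁻¹Q'` onto `{Q'A = 0}` on `ℓ²(ℤ^d)` (scalar shadow)

[B5] = T. Bałaban, *Propagators and renormalization transformations for lattice gauge theories. I*, Commun.
Math. Phys. **95** (1984) 17–40 [`Balaban1984PropagatorsI`].  PRINTED TEXT (TEXT LOCATIONS ONLY — nothing printed
enters as a hypothesis; quotations checked against the page renders `…1984-cmp95-propagators-rt-I-p018-x2.png`,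
`…-p019-x2.png` read as images): p. 34 [PDF 18]: «In a similar way we can construct another important operator
with the help of G, namely an orthogonal projection in the metric ⟨A, Δ_a A⟩ on the subspace of A satisfying the
conditions QA = 0, R∂*A = 0. This projection can be found as a minimum of the form ⟨A − A₀, Δ_a(A − A₀)⟩ on the
subspace of A₀ satisfying the conditions QA₀ = 0, R∂*A₀ = 0. We consider the function
g(A₀, ω, λ) = ½⟨A₀ − A, Δ_a(A₀ − A)⟩ + ⟨ω, QA₀⟩ + ⟨λ, R∂*A₀⟩, Rλ = λ,» (1.104) «and the equations
δg/δA₀ = Δ_a A₀ − Δ_a A + Q*ω + ∂λ = 0, δg/δω = QA₀ = 0, δg/δλ = R∂*A₀ = 0.» (1.105); p. 35 [PDF 19]: «The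
second equation gives QA₀ = QA − QG∂R∂*A − QGQ*ω = QA − QGQ*ω = 0, so we get the following formula for the
projection A₀ = PA = A − G∂R∂*A − GQ*(QGQ*)⁻¹QA,» (1.106) «or P = I − G∂R∂* − GQ*(QGQ*)⁻¹Q.» (1.107) «Thus all
the important operators we will work with in the future are expressed in terms of the operators G_k and G'_k.»

WHAT IS PROVED (kernel, [folklore] functional analysis on the column's objects; SCALAR whole-lattice `ℤ^d` shadow:
`U ≡ 1`, no axial-gauge constraint `R∂*A = 0`, no `λ`, `∂`, `R`; mesh `η = 1/(n+1)`, `a > 0`).  With the block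
average `Q'A (y) = (n+1)^{−d} Σ_{p ∈ B(y)} A(p)` (`QAvg`) and the column's `H = G'Q'*(Q'G'Q'*)⁻¹` on `ℓ²` data
(`B5Hk165L2Zd.HBZd`, `B5QGQInverseL2Zd.HBZd_eq_gq_KinvZd`), the scalar reading of (1.107) is the operator
`P A := A − H(Q'A)` (`PZd`), i.e. `P = I − G'Q'*(Q'G'Q'*)⁻¹Q'` (`PZd_eq_kernel`).  For every square-summable fine
field `A`:
* §1 `Q'` on `ℓ²`: linearity, `‖Q'A‖² ≤ (n+1)^{−d}‖A‖²` (`tsum_QAvg_sq_le`), `Q'H = I` on `ℓ²(ℤ^d)` (`QAvg_HBZd`),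
  linearity of `H`;
* §2 `P` is a projection onto `{Q'A = 0}`: `Q'P = 0` (`QAvg_PZd`), `P A ∈ ℓ²`, `P = I` on `{Q'A = 0}`, `P² = P`
  (`PZd_idem`), `P H = 0` (`PZd_HBZd`), `range P = ker Q'` (`PZd_eq_self_iff`), linearity, and the UNIQUE
  decomposition `A = A₀ + H B` with `Q'A₀ = 0`, `B ∈ ℓ²` forces `B = Q'A`, `A₀ = PA` (`decomp_unique`);
* §3 ORTHOGONALITY in the energy metric: `⟨(−Δ)HB, PA⟩ = 0` and the Pythagoras identities
  `E(HB + PA) = E(HB) + E(PA)`, `E(A) = E(HQ'A) + E(PA)` (`energy_HBZd_add_PZd`, `energy_eq_energy_HBZd_add`);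
* §4 the scalar (1.104)/(1.106): `PA` MINIMISES `E(A − A₀)` over square-summable `A₀` with `Q'A₀ = 0`, uniquely
  (`energy_sub_PZd_le`, `eq_PZd_of_energy_le`), and the scalar (1.105): `A₀ = PA` iff `Q'A₀ = 0` and `A − A₀`
  satisfies the weak Euler–Lagrange equation of the column (`eq_PZd_iff`);
* §5 the same statements in the metric of the column's fine operator `Δ^η + aQ'*Q'` (`B6QGQLower276.AX`, the
  scalar `Δ_a`): its quadratic form on `ℓ²` is `formA = (n+1)²E + a(n+1)^d‖Q'·‖²` (`inner_AX_eq_formA`), the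
  `a`-term is constant on the constraint set (`formA_sub_eq`), so `PA` minimises `⟨A − A₀, (Δ^η + aQ'*Q')(A − A₀)⟩`
  too (`formA_sub_PZd_le`) and `formA (HB + PA) = formA (HB) + formA (PA)` (`formA_HBZd_add_PZd`).
HONEST SCOPE: scalar, infinite lattice, `ℓ²` data only; the printed `P` carries the extra term `−G∂R∂*` of the
axial gauge, absent here; no printed constant or operator inequality is claimed; «orthogonal projection in the
metric ⟨A, Δ_a A⟩» is shadowed by the Pythagoras identities of §3/§5 and «minimum of the form …» by §4/§5.
ABSOLUTE RULE census: hypotheses are `0 < a` and square-summability of the fields involved (plus `Q'A₀ = 0` where a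
competitor `A₀` is named); no `def … : Prop`; the three `def`s are ℝ-valued operators / forms.  Cites:
[Balaban1984PropagatorsI] (1.104)–(1.107) pp. 34–35 — text locations; everything else [folklore].  Unit
`b2b-balaban-pv23-g10` (SURGE NODE PROVER #23 gen 10, scalar whole-lattice `ℤ^d` column, self-row
B5-PROJ-107-L2-ZD); staged byte-identically under `HOME/lean/BalabanYm4/`.
-/

namespace Literature.MathematicalPhysics.QuantumFieldTheory.Balaban1983to89.B5Proj107L2Zd

open Filter Topology
open B6QGQLower276 (X e B blk mem_B AX lapKer sameBlk lapKer_symm)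
open B6QGQDecay237 (card_B)
open B5Hk103ScalarZd (gq tsum_blocks summable_blocks nbhd lapKer_eq_zero_of_not_mem)
open B5Hk103Unique (lapRow BlockMeanZero WeakEL summable_mul_of_sq summable_comp_blk tsum_lapKer_mul'
  tsum_lapRow_mul_self summable_lapRow_mul)
open B5Hk103Minimizer (energy energy_add summable_sq_sub summable_sq_add)
open B5Hk165L2Zd (HBZd summable_HBZd_row summable_HBZd_sq sum_B_HBZd energy_HBZd_le eq_HBZd_of_energy_eq
  tsum_lapRow_HBZd_mul_eq_zero weakEL_HBZd HBZd_iff)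
open B5QGQInverseL2Zd (KinvZd HBZd_eq_gq_KinvZd)

noncomputable section

variable {d : ℕ}

/-! ## §1  The block average `Q'` and `H` on `ℓ²` [folklore] -/

/-- **`Q'`**, the block average: `(Q'A)(y) = (n+1)^{−d} Σ_{p ∈ B(y)} A(p)`. [folklore] -/
def QAvg (n : ℕ) (A : X d → ℝ) (y : X d) : ℝ := (((n : ℝ) + 1) ^ d)⁻¹ * ∑ p ∈ B n y, A p

/-- `Q'` is additive. [folklore] -/
theorem QAvg_add (n : ℕ) (A A' : X d → ℝ) (y : X d) :
    QAvg n (fun p => A p + A' p) y = QAvg n A y + QAvg n A' y := by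
  simp only [QAvg, Finset.sum_add_distrib, mul_add]

/-- `Q'` respects differences. [folklore] -/
theorem QAvg_sub (n : ℕ) (A A' : X d → ℝ) (y : X d) :
    QAvg n (fun p => A p - A' p) y = QAvg n A y - QAvg n A' y := by
  simp only [QAvg, Finset.sum_sub_distrib, mul_sub]

/-- `Q'` is homogeneous. [folklore] -/
theorem QAvg_smul (n : ℕ) (c : ℝ) (A : X d → ℝ) (y : X d) : QAvg n (fun p => c * A p) y = c * QAvg n A y := by
  simp only [QAvg, ← Finset.mul_sum]; ring

/-- `Q'0 = 0`. [folklore] -/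
theorem QAvg_zero (n : ℕ) (y : X d) : QAvg n (fun _ : X d => (0 : ℝ)) y = 0 := by simp [QAvg]

/-- Block sums in terms of `Q'`: `Σ_{p ∈ B(y)} A(p) = (n+1)^d (Q'A)(y)`. [folklore] -/
theorem sum_B_eq (n : ℕ) (A : X d → ℝ) (y : X d) : ∑ p ∈ B n y, A p = ((n : ℝ) + 1) ^ d * QAvg n A y := by
  have hn : ((n : ℝ) + 1) ^ d ≠ 0 := by positivity
  rw [QAvg, ← mul_assoc, mul_inv_cancel₀ hn, one_mul]

/-- `(Q'A)(y) = 0` iff the block sum over `B(y)` vanishes. [folklore] -/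
theorem QAvg_eq_zero_iff (n : ℕ) (A : X d → ℝ) (y : X d) : QAvg n A y = 0 ↔ ∑ p ∈ B n y, A p = 0 := by
  have hn : ((n : ℝ) + 1) ^ d ≠ 0 := by positivity
  rw [sum_B_eq]
  exact ⟨fun h => by rw [h, mul_zero], fun h => (mul_eq_zero.1 h).resolve_left hn⟩

/-- `Q'A = 0` iff all block sums vanish (the tree's `BlockMeanZero`). [folklore] -/
theorem blockMeanZero_iff (n : ℕ) (A : X d → ℝ) : BlockMeanZero n A ↔ ∀ y, QAvg n A y = 0 :=
  ⟨fun h y => (QAvg_eq_zero_iff n A y).2 (h y), fun h y => (QAvg_eq_zero_iff n A y).1 (h y)⟩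

/-- Jensen on a block: `(Σ_{B(y)} A)² ≤ (n+1)^d Σ_{B(y)} A²`. [folklore] -/
theorem sq_sum_B_le (n : ℕ) (A : X d → ℝ) (y : X d) :
    (∑ p ∈ B n y, A p) ^ 2 ≤ ((n : ℝ) + 1) ^ d * ∑ p ∈ B n y, A p ^ 2 := by
  have h := Finset.sum_mul_sq_le_sq_mul_sq (B n y) A fun _ => (1 : ℝ)
  simp only [mul_one, one_pow, Finset.sum_const, nsmul_eq_mul, card_B] at h
  linarith [h]

/-- `(Q'A)(y)² ≤ (n+1)^{−d} Σ_{B(y)} A²`. [folklore] -/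
theorem sq_QAvg_le (n : ℕ) (A : X d → ℝ) (y : X d) :
    QAvg n A y ^ 2 ≤ (((n : ℝ) + 1) ^ d)⁻¹ * ∑ p ∈ B n y, A p ^ 2 := by
  have hN : 0 < ((n : ℝ) + 1) ^ d := by positivity
  have h := sq_sum_B_le n A y
  rw [QAvg, mul_pow]
  calc (((n : ℝ) + 1) ^ d)⁻¹ ^ 2 * (∑ p ∈ B n y, A p) ^ 2
      ≤ (((n : ℝ) + 1) ^ d)⁻¹ ^ 2 * (((n : ℝ) + 1) ^ d * ∑ p ∈ B n y, A p ^ 2) :=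
        mul_le_mul_of_nonneg_left h (by positivity)
    _ = (((n : ℝ) + 1) ^ d)⁻¹ * ∑ p ∈ B n y, A p ^ 2 := by
        rw [pow_two, mul_assoc, ← mul_assoc ((((n : ℝ) + 1) ^ d)⁻¹) (((n : ℝ) + 1) ^ d), inv_mul_cancel₀ hN.ne',
          one_mul]

/-- `Q'` maps `ℓ²` (fine) into `ℓ²(ℤ^d)` (coarse). [folklore] -/
theorem summable_QAvg_sq (n : ℕ) {A : X d → ℝ} (hA : Summable fun p => A p ^ 2) :
    Summable fun y => QAvg n A y ^ 2 :=
  Summable.of_nonneg_of_le (fun _ => sq_nonneg _) (fun y => sq_QAvg_le n A y) ((summable_blocks n hA).mul_left _)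

/-- `‖Q'A‖² ≤ (n+1)^{−d}‖A‖²`. [folklore] -/
theorem tsum_QAvg_sq_le (n : ℕ) {A : X d → ℝ} (hA : Summable fun p => A p ^ 2) :
    ∑' y, QAvg n A y ^ 2 ≤ (((n : ℝ) + 1) ^ d)⁻¹ * ∑' p, A p ^ 2 :=
  calc ∑' y, QAvg n A y ^ 2 ≤ ∑' y, (((n : ℝ) + 1) ^ d)⁻¹ * ∑ p ∈ B n y, A p ^ 2 :=
        (summable_QAvg_sq n hA).tsum_le_tsum (fun y => sq_QAvg_le n A y) ((summable_blocks n hA).mul_left _)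
    _ = (((n : ℝ) + 1) ^ d)⁻¹ * ∑' p, A p ^ 2 := by rw [tsum_mul_left, tsum_blocks n hA]

/-- **`Q'H = I` on `ℓ²(ℤ^d)`**: `Q'(H B) = B` for every square-summable coarse `B` (the tree's `sum_B_HBZd`).
[cite: Balaban1984PropagatorsI, p.29] -/
theorem QAvg_HBZd (n : ℕ) {a : ℝ} (ha : 0 < a) {Bf : X d → ℝ} (hB : Summable fun x => Bf x ^ 2) (y : X d) :
    QAvg n (HBZd n a Bf) y = Bf y := by
  have hn : ((n : ℝ) + 1) ^ d ≠ 0 := by positivity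
  rw [QAvg, sum_B_HBZd n ha hB, ← mul_assoc, inv_mul_cancel₀ hn, one_mul]

/-- `H 0 = 0`. [folklore] -/
theorem HBZd_zero (n : ℕ) (a : ℝ) (p : X d) : HBZd n a (fun _ : X d => (0 : ℝ)) p = 0 := by simp [HBZd]

/-- Linearity of `H` on `ℓ²(ℤ^d)`. [folklore] -/
theorem HBZd_add (n : ℕ) {a : ℝ} (ha : 0 < a) {B₁ B₂ : X d → ℝ} (h₁ : Summable fun x => B₁ x ^ 2)
    (h₂ : Summable fun x => B₂ x ^ 2) (p : X d) :
    HBZd n a (fun y => B₁ y + B₂ y) p = HBZd n a B₁ p + HBZd n a B₂ p := by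
  simp only [HBZd, add_mul]
  exact (summable_HBZd_row n ha h₁ p).tsum_add (summable_HBZd_row n ha h₂ p)

/-- `H` respects differences on `ℓ²(ℤ^d)`. [folklore] -/
theorem HBZd_sub (n : ℕ) {a : ℝ} (ha : 0 < a) {B₁ B₂ : X d → ℝ} (h₁ : Summable fun x => B₁ x ^ 2)
    (h₂ : Summable fun x => B₂ x ^ 2) (p : X d) :
    HBZd n a (fun y => B₁ y - B₂ y) p = HBZd n a B₁ p - HBZd n a B₂ p := by
  simp only [HBZd, sub_mul]
  exact (summable_HBZd_row n ha h₁ p).tsum_sub (summable_HBZd_row n ha h₂ p)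

/-- `H` is homogeneous. [folklore] -/
theorem HBZd_smul (n : ℕ) (a c : ℝ) (Bf : X d → ℝ) (p : X d) :
    HBZd n a (fun y => c * Bf y) p = c * HBZd n a Bf p := by
  simp only [HBZd, mul_assoc]
  exact tsum_mul_left

/-! ## §2  `P = I − HQ' = I − G'Q'*(Q'G'Q'*)⁻¹Q'` is the projection onto `{Q'A = 0}` [cite (1.107) p.35, text location] -/

/-- **`P`**, the scalar reading of (1.107): `(PA)(p) = A(p) − (H(Q'A))(p)`, i.e. `P = I − G'Q'*(Q'G'Q'*)⁻¹Q'`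
(`PZd_eq_kernel`). [cite: Balaban1984PropagatorsI, (1.107) p.35] -/
def PZd (n : ℕ) (a : ℝ) (A : X d → ℝ) (p : X d) : ℝ := A p - HBZd n a (QAvg n A) p

/-- `A = PA + H(Q'A)`. [folklore] -/
theorem PZd_add_HBZd (n : ℕ) (a : ℝ) (A : X d → ℝ) (p : X d) : PZd n a A p + HBZd n a (QAvg n A) p = A p := by
  rw [PZd, sub_add_cancel]

/-- **(1.107) with (1.103) substituted**: `(PA)(p) = A(p) − Σ'_{y'} (G'Q'*)(p,y')·((Q'G'Q'*)⁻¹(Q'A))(y')`, the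
literal `P = I − G'Q'*(Q'G'Q'*)⁻¹Q'` on `ℓ²` data. [cite: Balaban1984PropagatorsI, (1.107) p.35] -/
theorem PZd_eq_kernel (n : ℕ) {a : ℝ} (ha : 0 < a) {A : X d → ℝ} (hA : Summable fun p => A p ^ 2) (p : X d) :
    PZd n a A p = A p - ∑' y' : X d, gq n a p y' * KinvZd n a (QAvg n A) y' := by
  rw [PZd, HBZd_eq_gq_KinvZd n ha (summable_QAvg_sq n hA)]

/-- **`Q'P = 0`** (block sums): every block sum of `PA` vanishes. [cite: Balaban1984PropagatorsI, (1.106) p.35] -/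
theorem sum_B_PZd (n : ℕ) {a : ℝ} (ha : 0 < a) {A : X d → ℝ} (hA : Summable fun p => A p ^ 2) (y : X d) :
    ∑ p ∈ B n y, PZd n a A p = 0 := by
  simp only [PZd, Finset.sum_sub_distrib]
  rw [sum_B_HBZd n ha (summable_QAvg_sq n hA), sum_B_eq, sub_self]

/-- `PA` has vanishing block sums (`BlockMeanZero`). [folklore] -/
theorem blockMeanZero_PZd (n : ℕ) {a : ℝ} (ha : 0 < a) {A : X d → ℝ} (hA : Summable fun p => A p ^ 2) :
    BlockMeanZero n (PZd n a A) := fun y => sum_B_PZd n ha hA y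

/-- **`Q'P = 0`**: `Q'(PA) = 0`. [cite: Balaban1984PropagatorsI, (1.106) p.35] -/
theorem QAvg_PZd (n : ℕ) {a : ℝ} (ha : 0 < a) {A : X d → ℝ} (hA : Summable fun p => A p ^ 2) (y : X d) :
    QAvg n (PZd n a A) y = 0 := by
  rw [QAvg, sum_B_PZd n ha hA, mul_zero]

/-- `P` maps `ℓ²` into `ℓ²`. [folklore] -/
theorem summable_PZd_sq (n : ℕ) {a : ℝ} (ha : 0 < a) {A : X d → ℝ} (hA : Summable fun p => A p ^ 2) :
    Summable fun p => PZd n a A p ^ 2 :=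
  summable_sq_sub hA (summable_HBZd_sq n ha (summable_QAvg_sq n hA))

/-- `P = I` on `{Q'A = 0}`. [folklore] -/
theorem PZd_eq_self_of_QAvg_zero (n : ℕ) (a : ℝ) {A : X d → ℝ} (hQ : ∀ y, QAvg n A y = 0) : PZd n a A = A := by
  funext p
  have h0 : QAvg n A = fun _ => 0 := funext hQ
  rw [PZd, h0, HBZd_zero, sub_zero]

/-- **`PH = 0`** (`P G'Q'*(Q'G'Q'*)⁻¹ = 0` on `ℓ²(ℤ^d)`). [folklore] -/
theorem PZd_HBZd (n : ℕ) {a : ℝ} (ha : 0 < a) {Bf : X d → ℝ} (hB : Summable fun x => Bf x ^ 2) :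
    PZd n a (HBZd n a Bf) = fun _ => 0 := by
  funext p
  have hQ : QAvg n (HBZd n a Bf) = Bf := funext (QAvg_HBZd n ha hB)
  rw [PZd, hQ, sub_self]

/-- **`P² = P`** on `ℓ²`. [folklore] -/
theorem PZd_idem (n : ℕ) {a : ℝ} (ha : 0 < a) {A : X d → ℝ} (hA : Summable fun p => A p ^ 2) :
    PZd n a (PZd n a A) = PZd n a A :=
  PZd_eq_self_of_QAvg_zero n a (QAvg_PZd n ha hA)

/-- **`range P = ker Q'`** (on `ℓ²`): `PA = A` iff `Q'A = 0`. [folklore] -/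
theorem PZd_eq_self_iff (n : ℕ) {a : ℝ} (ha : 0 < a) {A : X d → ℝ} (hA : Summable fun p => A p ^ 2) :
    PZd n a A = A ↔ ∀ y, QAvg n A y = 0 :=
  ⟨fun h y => by rw [← h]; exact QAvg_PZd n ha hA y, PZd_eq_self_of_QAvg_zero n a⟩

/-- Linearity of `P` on `ℓ²`. [folklore] -/
theorem PZd_add (n : ℕ) {a : ℝ} (ha : 0 < a) {A₁ A₂ : X d → ℝ} (h₁ : Summable fun p => A₁ p ^ 2)
    (h₂ : Summable fun p => A₂ p ^ 2) (p : X d) :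
    PZd n a (fun q => A₁ q + A₂ q) p = PZd n a A₁ p + PZd n a A₂ p := by
  have hQ : QAvg n (fun q => A₁ q + A₂ q) = fun y => QAvg n A₁ y + QAvg n A₂ y := funext (QAvg_add n A₁ A₂)
  rw [PZd, hQ, HBZd_add n ha (summable_QAvg_sq n h₁) (summable_QAvg_sq n h₂), PZd, PZd]
  ring

/-- `P` is homogeneous. [folklore] -/
theorem PZd_smul (n : ℕ) (a c : ℝ) (A : X d → ℝ) (p : X d) :
    PZd n a (fun q => c * A q) p = c * PZd n a A p := by
  have hQ : QAvg n (fun q => c * A q) = fun y => c * QAvg n A y := funext (QAvg_smul n c A)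
  rw [PZd, hQ, HBZd_smul, PZd]
  ring

/-- **Uniqueness of the decomposition `A = A₀ + HB`** (`Q'A₀ = 0`, `B ∈ ℓ²(ℤ^d)`): necessarily `B = Q'A` and
`A₀ = PA` — the fine lattice fields split as `{Q'A = 0} ⊕ H(ℓ²(ℤ^d))`. [folklore] -/
theorem decomp_unique (n : ℕ) {a : ℝ} (ha : 0 < a) {A A₀ Bf : X d → ℝ} (hB : Summable fun y => Bf y ^ 2)
    (hQ : ∀ y, QAvg n A₀ y = 0) (h : ∀ p, A p = A₀ p + HBZd n a Bf p) :
    Bf = QAvg n A ∧ A₀ = PZd n a A := by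
  have hBQ : Bf = QAvg n A := by
    funext y
    have hA : A = fun p => A₀ p + HBZd n a Bf p := funext h
    rw [hA, QAvg_add, hQ, QAvg_HBZd n ha hB, zero_add]
  refine ⟨hBQ, funext fun p => ?_⟩
  rw [PZd, ← hBQ, h p, add_sub_cancel_right]

/-! ## §3  Orthogonality in the energy metric [cite p.34 «orthogonal projection», text location] -/

/-- **`⟨(−Δ)HB, PA⟩ = 0`**: `range H ⊥ range P` in the Dirichlet-energy inner product (node 2's weak
Euler–Lagrange orthogonality applied to the block-mean-zero field `PA`). [cite: Balaban1984PropagatorsI, p.34] -/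
theorem tsum_lapRow_HBZd_mul_PZd (n : ℕ) {a : ℝ} (ha : 0 < a) {A Bf : X d → ℝ} (hA : Summable fun p => A p ^ 2)
    (hB : Summable fun y => Bf y ^ 2) : ∑' p, lapRow (HBZd n a Bf) p * PZd n a A p = 0 :=
  tsum_lapRow_HBZd_mul_eq_zero n ha hB (summable_PZd_sq n ha hA) (blockMeanZero_PZd n ha hA)

/-- **Pythagoras** `E(HB + PA) = E(HB) + E(PA)` for all `A ∈ ℓ²`, `B ∈ ℓ²(ℤ^d)` — `P` is an ORTHOGONAL projection
for the energy. [cite: Balaban1984PropagatorsI, p.34] -/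
theorem energy_HBZd_add_PZd (n : ℕ) {a : ℝ} (ha : 0 < a) {A Bf : X d → ℝ} (hA : Summable fun p => A p ^ 2)
    (hB : Summable fun y => Bf y ^ 2) :
    energy (fun p => HBZd n a Bf p + PZd n a A p) = energy (HBZd n a Bf) + energy (PZd n a A) := by
  rw [energy_add (summable_HBZd_sq n ha hB) (summable_PZd_sq n ha hA), tsum_lapRow_HBZd_mul_PZd n ha hA hB,
    mul_zero, add_zero]

/-- `E(A) = E(H Q'A) + E(PA)`. [folklore] -/
theorem energy_eq_energy_HBZd_add (n : ℕ) {a : ℝ} (ha : 0 < a) {A : X d → ℝ} (hA : Summable fun p => A p ^ 2) :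
    energy A = energy (HBZd n a (QAvg n A)) + energy (PZd n a A) := by
  have h := energy_HBZd_add_PZd n ha hA (summable_QAvg_sq n hA)
  have hA' : (fun p => HBZd n a (QAvg n A) p + PZd n a A p) = A :=
    funext fun p => by rw [add_comm]; exact PZd_add_HBZd n a A p
  rwa [hA'] at h

/-- `E(PA) ≤ E(A)`. [folklore] -/
theorem energy_PZd_le (n : ℕ) {a : ℝ} (ha : 0 < a) {A : X d → ℝ} (hA : Summable fun p => A p ^ 2) :
    energy (PZd n a A) ≤ energy A := by
  rw [energy_eq_energy_HBZd_add n ha hA]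
  have h0 : 0 ≤ energy (HBZd n a (QAvg n A)) := Finset.sum_nonneg fun μ _ => tsum_nonneg fun p => sq_nonneg _
  linarith

/-! ## §4  (1.104)/(1.106): `PA` is the energy-closest point of `{Q'A₀ = 0}`; (1.105) [cite pp.34–35, text locations] -/

/-- `A − PA = H(Q'A)`. [folklore] -/
theorem sub_PZd_eq (n : ℕ) (a : ℝ) (A : X d → ℝ) : (fun p => A p - PZd n a A p) = HBZd n a (QAvg n A) := by
  funext p
  rw [PZd, sub_sub_cancel]

/-- Block sums of `A − A₀` for a competitor with `Q'A₀ = 0`. [folklore] -/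
theorem sum_B_sub_eq (n : ℕ) {A A₀ : X d → ℝ} (hQ : ∀ y, QAvg n A₀ y = 0) (y : X d) :
    ∑ p ∈ B n y, (A p - A₀ p) = ((n : ℝ) + 1) ^ d * QAvg n A y := by
  rw [Finset.sum_sub_distrib, sum_B_eq n A y, (QAvg_eq_zero_iff n A₀ y).1 (hQ y), sub_zero]

/-- **(1.104)/(1.106), scalar, on `ℓ²`**: for every square-summable `A₀` with `Q'A₀ = 0`,
`E(A − PA) ≤ E(A − A₀)` — `PA` realises «a minimum of the form ⟨A − A₀, Δ_a(A − A₀)⟩ on the subspace of A₀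
satisfying the conditions QA₀ = 0» (energy part; the `a`-term is constant there, §5).
[cite: Balaban1984PropagatorsI, (1.104)/(1.106) pp.34–35] -/
theorem energy_sub_PZd_le (n : ℕ) {a : ℝ} (ha : 0 < a) {A A₀ : X d → ℝ} (hA : Summable fun p => A p ^ 2)
    (hA₀ : Summable fun p => A₀ p ^ 2) (hQ : ∀ y, QAvg n A₀ y = 0) :
    energy (fun p => A p - PZd n a A p) ≤ energy (fun p => A p - A₀ p) := by
  rw [sub_PZd_eq]
  refine energy_HBZd_le n ha (summable_QAvg_sq n hA) _ ?_ (sum_B_sub_eq n hQ)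
  have h : (fun p => (A p - A₀ p - HBZd n a (QAvg n A) p) ^ 2) = fun p => (PZd n a A p - A₀ p) ^ 2 :=
    funext fun p => by rw [PZd]; ring
  rw [h]
  exact summable_sq_sub (summable_PZd_sq n ha hA) hA₀

/-- **Uniqueness of the minimiser**: a square-summable competitor `A₀` with `Q'A₀ = 0` doing at least as well as
`PA` IS `PA`. [cite: Balaban1984PropagatorsI, (1.106) p.35] -/
theorem eq_PZd_of_energy_le (n : ℕ) {a : ℝ} (ha : 0 < a) {A A₀ : X d → ℝ} (hA : Summable fun p => A p ^ 2)
    (hA₀ : Summable fun p => A₀ p ^ 2) (hQ : ∀ y, QAvg n A₀ y = 0)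
    (hE : energy (fun p => A p - A₀ p) ≤ energy (fun p => A p - PZd n a A p)) : A₀ = PZd n a A := by
  have h2 : Summable fun p => (A p - A₀ p - HBZd n a (QAvg n A) p) ^ 2 := by
    have h : (fun p => (A p - A₀ p - HBZd n a (QAvg n A) p) ^ 2) = fun p => (PZd n a A p - A₀ p) ^ 2 :=
      funext fun p => by rw [PZd]; ring
    rw [h]
    exact summable_sq_sub (summable_PZd_sq n ha hA) hA₀
  have hge := energy_sub_PZd_le n ha hA hA₀ hQ
  rw [sub_PZd_eq] at hE hge
  have h := eq_HBZd_of_energy_eq n ha (summable_QAvg_sq n hA) (fun p => A p - A₀ p) h2 (sum_B_sub_eq n hQ)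
    (le_antisymm hE hge)
  funext p
  have hp : A p - A₀ p = HBZd n a (QAvg n A) p := congr_fun h p
  rw [PZd, ← hp]
  ring

/-- **(1.105), scalar, on `ℓ²`**: for square-summable `A`, `A₀`: `A₀ = PA` iff `Q'A₀ = 0` and `A − A₀` satisfies
the column's weak Euler–Lagrange equation («Δ_a A₀ − Δ_a A + Q*ω = 0, QA₀ = 0» without `∂λ`).
[cite: Balaban1984PropagatorsI, (1.105) p.34] -/
theorem eq_PZd_iff (n : ℕ) {a : ℝ} (ha : 0 < a) {A A₀ : X d → ℝ} (hA : Summable fun p => A p ^ 2)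
    (hA₀ : Summable fun p => A₀ p ^ 2) :
    A₀ = PZd n a A ↔ (∀ y, QAvg n A₀ y = 0) ∧ WeakEL n (fun p => A p - A₀ p) := by
  constructor
  · intro h
    refine ⟨fun y => by rw [h]; exact QAvg_PZd n ha hA y, ?_⟩
    rw [h, sub_PZd_eq]
    exact weakEL_HBZd n ha (summable_QAvg_sq n hA)
  · rintro ⟨hQ, hEL⟩
    have h := (HBZd_iff n ha (summable_QAvg_sq n hA) (fun p => A p - A₀ p) (summable_sq_sub hA hA₀)).2
      ⟨sum_B_sub_eq n hQ, hEL⟩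
    funext p
    have hp : A p - A₀ p = HBZd n a (QAvg n A) p := congr_fun h p
    rw [PZd, ← hp]
    ring

/-! ## §5  The same in the metric of `Δ^η + aQ'*Q'` (the scalar `Δ_a`) [folklore] -/

/-- The quadratic form of the column's fine operator `AX n a = Δ^η + aQ'*Q'` (`B6QGQLower276.AX`) on `ℓ²`:
`(n+1)²·E(C) + a(n+1)^d·‖Q'C‖²` (`inner_AX_eq_formA`). [folklore] -/
def formA (n : ℕ) (a : ℝ) (C : X d → ℝ) : ℝ :=
  ((n : ℝ) + 1) ^ 2 * energy C + a * ((n : ℝ) + 1) ^ d * ∑' y, QAvg n C y ^ 2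

/-- The row action of `Δ^η + aQ'*Q'`: `Σ'_r AX(p,r)C(r) = (n+1)²((−Δ)C)(p) + a(n+1)^{−d} Σ_{r ∈ B(p)} C(r)`. [folklore] -/
theorem tsum_AX_mul_eq (n : ℕ) (a : ℝ) (C : X d → ℝ) (p : X d) :
    ∑' r, AX n a p r * C r =
      ((n : ℝ) + 1) ^ 2 * lapRow C p + a / ((n : ℝ) + 1) ^ d * ∑ r ∈ B n (blk n p), C r := by
  classical
  have hlap : ∀ r ∉ nbhd n p, lapKer p r * C r = 0 := fun r hr => by
    rw [lapKer_eq_zero_of_not_mem (n := n) hr, zero_mul]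
  have hblk : ∀ r ∉ B n (blk n p), sameBlk n p r * C r = 0 := fun r hr => by
    have : blk n p ≠ blk n r := fun h => hr (mem_B.2 h.symm)
    simp [sameBlk, this]
  have h1 : Summable fun r => lapKer p r * C r := summable_of_ne_finset_zero hlap
  have h2 : Summable fun r => sameBlk n p r * C r := summable_of_ne_finset_zero hblk
  have hsplit : (fun r => AX n a p r * C r) =
      fun r => ((n : ℝ) + 1) ^ 2 * (lapKer p r * C r) + a / ((n : ℝ) + 1) ^ d * (sameBlk n p r * C r) := by
    funext r; simp only [AX]; ring
  rw [hsplit, (h1.mul_left _).tsum_add (h2.mul_left _), tsum_mul_left, tsum_mul_left]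
  congr 1
  · congr 1
    rw [← tsum_lapKer_mul' p C]
    exact tsum_congr fun r => by rw [lapKer_symm]
  · congr 1
    rw [tsum_eq_sum (s := B n (blk n p)) hblk]
    refine Finset.sum_congr rfl fun r hr => ?_
    have : blk n p = blk n r := (mem_B.1 hr).symm
    simp [sameBlk, this]

/-- **`⟨C, (Δ^η + aQ'*Q')C⟩ = (n+1)²E(C) + a(n+1)^d‖Q'C‖²`** for `C ∈ ℓ²`. [folklore] -/
theorem inner_AX_eq_formA (n : ℕ) (a : ℝ) {C : X d → ℝ} (hC : Summable fun p => C p ^ 2) :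
    ∑' p, C p * ∑' r, AX n a p r * C r = formA n a C := by
  have hn : ((n : ℝ) + 1) ^ d ≠ 0 := by positivity
  have hS2 : Summable fun y => (∑ r ∈ B n y, C r) ^ 2 := by
    refine ((summable_QAvg_sq n hC).mul_left ((((n : ℝ) + 1) ^ d) ^ 2)).congr fun y => ?_
    rw [sum_B_eq, mul_pow]
  have hcomp : Summable fun p => (∑ r ∈ B n (blk n p), C r) ^ 2 := by
    have h := summable_comp_blk n hS2 fun y => sq_nonneg (∑ r ∈ B n y, C r)
    exact h
  have hblk : Summable fun p => C p * ∑ r ∈ B n (blk n p), C r := summable_mul_of_sq hC hcomp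
  have hlap : Summable fun p => C p * lapRow C p := (summable_lapRow_mul hC).congr fun p => mul_comm _ _
  have hE : ∑' p, C p * lapRow C p = energy C :=
    calc ∑' p, C p * lapRow C p = ∑' p, lapRow C p * C p := tsum_congr fun p => mul_comm _ _
      _ = energy C := by rw [tsum_lapRow_mul_self hC, energy]
  have hQ : ∑' p, C p * ∑ r ∈ B n (blk n p), C r = (((n : ℝ) + 1) ^ d) ^ 2 * ∑' y, QAvg n C y ^ 2 := by
    rw [← tsum_blocks n hblk, ← tsum_mul_left]
    refine tsum_congr fun y => ?_
    have h : ∀ p ∈ B n y, C p * ∑ r ∈ B n (blk n p), C r = C p * ∑ r ∈ B n y, C r := fun p hp => by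
      rw [mem_B.1 hp]
    rw [Finset.sum_congr rfl h, ← Finset.sum_mul, sum_B_eq]
    ring
  have hterm : ∀ p, C p * ∑' r, AX n a p r * C r =
      ((n : ℝ) + 1) ^ 2 * (C p * lapRow C p) + a / ((n : ℝ) + 1) ^ d * (C p * ∑ r ∈ B n (blk n p), C r) :=
    fun p => by rw [tsum_AX_mul_eq]; ring
  calc ∑' p, C p * ∑' r, AX n a p r * C r
      = ∑' p, (((n : ℝ) + 1) ^ 2 * (C p * lapRow C p) +
          a / ((n : ℝ) + 1) ^ d * (C p * ∑ r ∈ B n (blk n p), C r)) := tsum_congr hterm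
    _ = ((n : ℝ) + 1) ^ 2 * ∑' p, C p * lapRow C p +
          a / ((n : ℝ) + 1) ^ d * ∑' p, C p * ∑ r ∈ B n (blk n p), C r := by
        rw [(hlap.mul_left (((n : ℝ) + 1) ^ 2)).tsum_add (hblk.mul_left (a / ((n : ℝ) + 1) ^ d)), tsum_mul_left,
          tsum_mul_left]
    _ = formA n a C := by
        rw [hE, hQ, formA, ← mul_assoc, div_mul_eq_mul_div,
          show a * (((n : ℝ) + 1) ^ d) ^ 2 / ((n : ℝ) + 1) ^ d = a * ((n : ℝ) + 1) ^ d by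
            rw [div_eq_iff hn]; ring]

/-- The `Δ^η + aQ'*Q'` form is non-negative for `a ≥ 0`. [folklore] -/
theorem formA_nonneg (n : ℕ) {a : ℝ} (ha : 0 ≤ a) (C : X d → ℝ) : 0 ≤ formA n a C := by
  have h0 : 0 ≤ energy C := Finset.sum_nonneg fun μ _ => tsum_nonneg fun p => sq_nonneg _
  have h1 : 0 ≤ ∑' y, QAvg n C y ^ 2 := tsum_nonneg fun _ => sq_nonneg _
  unfold formA
  positivity

/-- On the constraint set the `a`-term is constant: `Q'(A − A₀) = Q'A` when `Q'A₀ = 0`, so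
`formA (A − A₀) = (n+1)²E(A − A₀) + a(n+1)^d‖Q'A‖²`. [folklore] -/
theorem formA_sub_eq (n : ℕ) (a : ℝ) {A A₀ : X d → ℝ} (hQ : ∀ y, QAvg n A₀ y = 0) :
    formA n a (fun p => A p - A₀ p) =
      ((n : ℝ) + 1) ^ 2 * energy (fun p => A p - A₀ p) + a * ((n : ℝ) + 1) ^ d * ∑' y, QAvg n A y ^ 2 := by
  have h : (fun y => QAvg n (fun p => A p - A₀ p) y ^ 2) = fun y => QAvg n A y ^ 2 := by
    funext y; rw [QAvg_sub, hQ, sub_zero]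
  rw [formA, h]

/-- **(1.104)/(1.106) in the `Δ^η + aQ'*Q'` metric**: `PA` minimises `⟨A − A₀, (Δ^η + aQ'*Q')(A − A₀)⟩` over
square-summable `A₀` with `Q'A₀ = 0`. [cite: Balaban1984PropagatorsI, (1.104)/(1.106) pp.34–35] -/
theorem formA_sub_PZd_le (n : ℕ) {a : ℝ} (ha : 0 < a) {A A₀ : X d → ℝ} (hA : Summable fun p => A p ^ 2)
    (hA₀ : Summable fun p => A₀ p ^ 2) (hQ : ∀ y, QAvg n A₀ y = 0) :
    formA n a (fun p => A p - PZd n a A p) ≤ formA n a (fun p => A p - A₀ p) := by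
  rw [formA_sub_eq n a hQ, formA_sub_eq n a (QAvg_PZd n ha hA)]
  have h := energy_sub_PZd_le n ha hA hA₀ hQ
  have hn : 0 ≤ ((n : ℝ) + 1) ^ 2 := by positivity
  nlinarith

/-- **Pythagoras in the `Δ^η + aQ'*Q'` metric**: `formA (HB + PA) = formA (HB) + formA (PA)` — `P` is an
orthogonal projection for the scalar `Δ_a`-form as well. [cite: Balaban1984PropagatorsI, p.34] -/
theorem formA_HBZd_add_PZd (n : ℕ) {a : ℝ} (ha : 0 < a) {A Bf : X d → ℝ} (hA : Summable fun p => A p ^ 2)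
    (hB : Summable fun y => Bf y ^ 2) :
    formA n a (fun p => HBZd n a Bf p + PZd n a A p) = formA n a (HBZd n a Bf) + formA n a (PZd n a A) := by
  have hQ1 : (fun y => QAvg n (fun p => HBZd n a Bf p + PZd n a A p) y ^ 2) = fun y => Bf y ^ 2 := by
    funext y; rw [QAvg_add, QAvg_HBZd n ha hB, QAvg_PZd n ha hA, add_zero]
  have hQ2 : (fun y => QAvg n (HBZd n a Bf) y ^ 2) = fun y => Bf y ^ 2 := by
    funext y; rw [QAvg_HBZd n ha hB]
  have hQ3 : (fun y => QAvg n (PZd n a A) y ^ 2) = fun _ => 0 := by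
    funext y; rw [QAvg_PZd n ha hA]; ring
  simp only [formA, hQ1, hQ2, hQ3, tsum_zero, mul_zero, add_zero]
  rw [energy_HBZd_add_PZd n ha hA hB]
  ring

/-- **Summary** (scalar (1.104)–(1.107) on `ℓ²(ℤ^d)`): for square-summable `A`, `P = I − G'Q'*(Q'G'Q'*)⁻¹Q'`
satisfies `Q'P = 0`, `P² = P`, `E(A) = E(HQ'A) + E(PA)`, and `PA` minimises `E(A − A₀)` over square-summable
`A₀` with `Q'A₀ = 0`. [cite: Balaban1984PropagatorsI, (1.104)–(1.107) pp.34–35] -/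
theorem projection_identities (n : ℕ) {a : ℝ} (ha : 0 < a) {A : X d → ℝ} (hA : Summable fun p => A p ^ 2) :
    (∀ p, PZd n a A p = A p - ∑' y' : X d, gq n a p y' * KinvZd n a (QAvg n A) y') ∧
      (∀ y, QAvg n (PZd n a A) y = 0) ∧ PZd n a (PZd n a A) = PZd n a A ∧
        energy A = energy (HBZd n a (QAvg n A)) + energy (PZd n a A) ∧
          ∀ A₀ : X d → ℝ, (Summable fun p => A₀ p ^ 2) → (∀ y, QAvg n A₀ y = 0) →
            energy (fun p => A p - PZd n a A p) ≤ energy (fun p => A p - A₀ p) :=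
  ⟨PZd_eq_kernel n ha hA, QAvg_PZd n ha hA, PZd_idem n ha hA, energy_eq_energy_HBZd_add n ha hA,
    fun _ hA₀ hQ => energy_sub_PZd_le n ha hA hA₀ hQ⟩

end

end Literature.MathematicalPhysics.QuantumFieldTheory.Balaban1983to89.B5Proj107L2Zd
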